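import Literature.Geometry.Manifold.ChartConvexToSmooth
import Literature.Geometry.Manifold.DeRhamComparison
import Literature.Geometry.Kaehler.HolomorphicLineBundle
import Literature.AlgebraicTopology.SingularHomology.RelativeCapProduct
import HarnessLib

/-!
# Smooth integer cycles of nerve cycles, and their periods

The homological half of the Čech integrality step of Lefschetz's theorem on `(1,1)`-classes
("integral classes have integral Čech cocycles": Weil (1952), §3; Bott–Tu (1982), Thm. 8.9,
Prop. 9.5, Thm. 15.8), carried out on CHAINS, where integrality is visible: a singular chain with
integer coefficients pairs integrally with an integer-valued cocycle.

Let `(U_i)_{i ∈ ι}` be a finite open family of a `C^∞` manifold `M` whose members and pairwise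
intersections are empty or chart sets of nonempty convex sets (the shape of a chart-convex cover),
and let `m = ∑_s m_s [s]` be an integer `2`-cycle of its ORDERED nerve (ordered triples
`s = (i, j, k)` with `U_i ∩ U_j ∩ U_k ≠ ∅`; boundary `∂[i,j,k] = [j,k] − [i,k] + [i,j]`, encoded by the
triangle–edge incidence numbers `B_{s t}`).

* `exists_bd_eq_of_coeffSum_eq_zero`, `exists_bd_eq_of_bd_eq_zero` — in a chart-convex set, integer
  `0`-chains of total multiplicity `0` bound smooth integer `1`-chains and smooth integer `1`-cycles
  bound smooth integer `2`-chains (prism operator of the chart contraction,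
  `Literature.Geometry.Manifold.prismOp`, and its identity `∂P + P∂ = κ − 𝟙`; Bredon (1993),
  Lemma V.9.2);
* `exists_smooth_int_cycle_period_eq` — the tic-tac-toe run downstairs: points `x_s ∈ U_s`, paths
  `η_t ⊆ U_a ∩ U_b` with `∂η_t = ∑_s m_s B_{s t} [x_s]`, `2`-chains `η₂_i ⊆ U_i` bounding the
  `1`-cycles `∑_t D_{t i} η_t`, and the smooth INTEGER `2`-cycle `S = ∑_i η₂_i` of `M`; for every
  real zigzag `θ = dα_i` on `U_i`, `α_i − α_j = df_ij` on `U_i ∩ U_j`, `f_ij + f_jk − f_ik = c_ijk`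
  on `U_i ∩ U_j ∩ U_k`, three applications of Stokes' formula give the PERIOD
  `∫_S θ = −∑_s m_s c_s`;
* `integrationFunctional_eq_sum_of_comparison_eq_π` — if the de Rham comparison isomorphism
  (`Literature.Geometry.Manifold.deRhamComparisonIso`, integration over smooth simplices) sends
  `[θ]` to the class of a singular cocycle `ζ`, then `∫_S θ = ∑_σ S_σ ζ(σ)` for every smooth cycle
  `S` (so periods of integral classes over smooth integer cycles are integers).

Also: bookkeeping of real chains with integer coefficients (`isInt_*`), Stokes in the pointwise form
used by zigzags (`integrationFunctional_eq_bd_of_mextDeriv_eq`), and the incidence identities of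
the ordered nerve (`sum_nerveIncidence_mul`, `∂∂ = 0`). No named facts; everything is proved.

## References

* A. Weil, *Sur les théorèmes de de Rham*, Comment. Math. Helv. 26 (1952), §3.
* R. Bott, L. W. Tu, *Differential Forms in Algebraic Topology*, GTM 82 (1982), §8 (8.4), Thm. 8.9,
  Prop. 9.5, Thm. 15.8. [BottTu1982Forms]
* G. E. Bredon, *Topology and Geometry*, GTM 139 (1993), Lemma V.9.2, Thm. V.9.5. [Bredon1993]
* J. M. Lee, *Introduction to Smooth Manifolds*, 2nd ed. (2013), Thm. 18.12, p. 481.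
  [LeeSmoothManifolds2013]
-/

noncomputable section

-- as in `…SingularHomology.SingularChainsConcrete`: chains are `Finsupp`s up to unfolding
set_option backward.isDefEq.respectTransparency false

open scoped Manifold ContDiff Topology
open CategoryTheory Limits Set Literature.AlgebraicTopology.SingularHomology Literature.Geometry.Kaehler

universe u

namespace Literature.Geometry.Manifold



/-! ### Integer chains among real chains -/

section IntChains

variable {X : Type u} [TopologicalSpace X] {n k : ℕ}

/-- The zero chain has integer coefficients. [folklore] -/
theorem isInt_zero : ∀ σ, ∃ m : ℤ, (0 : CChain ℝ X n) σ = m := fun _ ↦ ⟨0, by simp⟩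

/-- Sums of integer chains are integer chains. [folklore] -/
theorem isInt_add {x y : CChain ℝ X n} (hx : ∀ σ, ∃ m : ℤ, x σ = m) (hy : ∀ σ, ∃ m : ℤ, y σ = m) :
    ∀ σ, ∃ m : ℤ, (x + y) σ = m := fun σ ↦ by
  obtain ⟨a, ha⟩ := hx σ
  obtain ⟨b, hb⟩ := hy σ
  exact ⟨a + b, by rw [Finsupp.add_apply, ha, hb, Int.cast_add]⟩

/-- Negatives of integer chains are integer chains. [folklore] -/
theorem isInt_neg {x : CChain ℝ X n} (hx : ∀ σ, ∃ m : ℤ, x σ = m) : ∀ σ, ∃ m : ℤ, (-x) σ = m := fun σ ↦ by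
  obtain ⟨a, ha⟩ := hx σ
  exact ⟨-a, by rw [Finsupp.neg_apply, ha, Int.cast_neg]⟩

/-- Differences of integer chains are integer chains. [folklore] -/
theorem isInt_sub {x y : CChain ℝ X n} (hx : ∀ σ, ∃ m : ℤ, x σ = m) (hy : ∀ σ, ∃ m : ℤ, y σ = m) :
    ∀ σ, ∃ m : ℤ, (x - y) σ = m := by
  rw [sub_eq_add_neg]
  exact isInt_add hx (isInt_neg hy)

/-- Integer multiples of integer chains are integer chains. [folklore] -/
theorem isInt_smul {x : CChain ℝ X n} (hx : ∀ σ, ∃ m : ℤ, x σ = m) (a : ℤ) :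
    ∀ σ, ∃ m : ℤ, ((a : ℝ) • x) σ = m := fun σ ↦ by
  obtain ⟨b, hb⟩ := hx σ
  exact ⟨a * b, by rw [Finsupp.smul_apply, hb, smul_eq_mul, Int.cast_mul]⟩

/-- Finite sums of integer chains are integer chains. [folklore] -/
theorem isInt_sum {β : Type*} {s : Finset β} {x : β → CChain ℝ X n}
    (h : ∀ b ∈ s, ∀ σ, ∃ m : ℤ, x b σ = m) : ∀ σ, ∃ m : ℤ, (∑ b ∈ s, x b) σ = m := by
  classical
  induction s using Finset.induction_on with
  | empty => intro σ; exact ⟨0, by simp⟩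
  | insert b s hb ih =>
    rw [Finset.sum_insert hb]
    exact isInt_add (h b (Finset.mem_insert_self b s)) (ih fun b' hb' ↦ h b' (Finset.mem_insert_of_mem hb'))

/-- An elementary chain with integer coefficient is an integer chain. [folklore] -/
theorem isInt_single (τ : SingularSimplex X n) (a : ℤ) :
    ∀ σ, ∃ m : ℤ, (Finsupp.single τ (a : ℝ) : CChain ℝ X n) σ = m := fun σ ↦ by
  classical
  by_cases h : τ = σ
  · subst h; exact ⟨a, by rw [Finsupp.single_eq_same]⟩
  · exact ⟨0, by rw [Finsupp.single_apply, if_neg h, Int.cast_zero]⟩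

/-- A linear operator on chains which sends elementary integer chains to integer chains preserves
integer chains. [folklore] -/
theorem isInt_map (f : CChain ℝ X n →ₗ[ℝ] CChain ℝ X k)
    (hf : ∀ (τ : SingularSimplex X n) (a : ℤ), ∀ σ, ∃ m : ℤ, f (Finsupp.single τ (a : ℝ)) σ = m)
    {x : CChain ℝ X n} (hx : ∀ σ, ∃ m : ℤ, x σ = m) : ∀ σ, ∃ m : ℤ, f x σ = m := by
  conv => enter [σ, 1, m]; rw [← Finsupp.sum_single x]
  rw [Finsupp.sum, map_sum]
  refine isInt_sum fun τ _ ↦ ?_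
  obtain ⟨a, ha⟩ := hx τ
  rw [ha]
  exact hf τ a

/-- Signs `(-1)^i` times integer chains are integer chains. [folklore] -/
theorem isInt_neg_one_pow_smul {x : CChain ℝ X n} (hx : ∀ σ, ∃ m : ℤ, x σ = m) (i : ℕ) :
    ∀ σ, ∃ m : ℤ, (((-1 : ℝ) ^ i) • x) σ = m := by
  have h := isInt_smul hx ((-1) ^ i)
  rwa [Int.cast_pow, Int.cast_neg, Int.cast_one] at h

/-- **The boundary of an integer chain is an integer chain.** [folklore] -/
theorem isInt_bd {x : CChain ℝ X (n + 1)} (hx : ∀ σ, ∃ m : ℤ, x σ = m) :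
    ∀ σ, ∃ m : ℤ, csingularChainComplex.bd ℝ n x σ = m := by
  refine isInt_map _ (fun τ a ↦ ?_) hx
  rw [csingularChainComplex.bd_single]
  exact isInt_sum fun i _ ↦ isInt_neg_one_pow_smul (isInt_single _ a) _

/-- **The coefficient sum of an integer chain is an integer.** [folklore] -/
theorem exists_coeffSum_eq_of_isInt {x : CChain ℝ X n} (hx : ∀ σ, ∃ m : ℤ, x σ = m) :
    ∃ m : ℤ, Compression.coeffSum ℝ n x = m := by
  classical
  have key : ∀ (s : Finset (SingularSimplex X n)),
      ∃ m : ℤ, Compression.coeffSum ℝ n (∑ τ ∈ s, Finsupp.single τ (x τ)) = m := by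
    intro s
    induction s using Finset.induction_on with
    | empty => exact ⟨0, by simp⟩
    | insert b s hb ih =>
      obtain ⟨m, hm⟩ := ih
      obtain ⟨a, ha⟩ := hx b
      refine ⟨a + m, ?_⟩
      rw [Finset.sum_insert hb, map_add, Compression.coeffSum_single, hm, ha, Int.cast_add]
  have h := key x.support
  have e : ∑ τ ∈ x.support, Finsupp.single τ (x τ) = x := Finsupp.sum_single x
  rwa [e] at h

end IntChains

/-! ### Integer fillings in chart-convex sets -/

section Fillings

variable {E : Type u} [NormedAddCommGroup E] [NormedSpace ℝ E]
  {H : Type u} [TopologicalSpace H] {I : ModelWithCorners ℝ E H}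
  {M : Type u} [TopologicalSpace M] [ChartedSpace H M]
  {p : M} {C : Set E} {c : E}
  (hCc : Convex ℝ C) (hCT : C ⊆ (extChartAt I p).target) (hc : c ∈ C)

/-- **The prism operator of the chart contraction preserves integer chains** (its matrix entries
are `0, ±1`). [folklore] -/
theorem isInt_prismOp {n : ℕ} {x : CChain ℝ M n} (hx : ∀ σ, ∃ m : ℤ, x σ = m) :
    ∀ σ, ∃ m : ℤ, prismOp hCc hCT hc ℝ ℝ n x σ = m := by
  refine isInt_map _ (fun τ a ↦ ?_) hx
  by_cases hτ : τ.range ⊆ chartSet I p C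
  · rw [prismOp_single hCc hCT hc hτ]
    exact isInt_sum fun i _ ↦ isInt_neg_one_pow_smul (isInt_single _ a) _
  · rw [prismOp_single_of_not hCc hCT hc hτ]
    exact isInt_zero

variable [IsManifold I ∞ M]

include hCc hCT hc in
/-- **Integer `0`-chains of total multiplicity zero bound smooth integer `1`-chains in a chart-convex
set**: `y = ∂(−P y)` by the prism identity `∂P = κ − 𝟙` in dimension `0` and `κ y = (∑ y) • [q] = 0`.
[cite: Bredon1993, Lemma V.9.2] -/
theorem exists_bd_eq_of_coeffSum_eq_zero_chartSet (y : CChain ℝ M 0)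
    (hy : y ∈ chainsIn ℝ ℝ M (chartSet I p C) 0) (hyi : ∀ σ, ∃ m : ℤ, y σ = m)
    (hsum : Compression.coeffSum ℝ 0 y = 0) :
    ∃ η : CChain ℝ M 1, η ∈ smoothChainsInSub I ℝ ℝ M (chartSet I p C) 1 ∧
      (∀ σ, ∃ m : ℤ, η σ = m) ∧ csingularChainComplex.bd ℝ 0 η = y := by
  refine ⟨-prismOp hCc hCT hc ℝ ℝ 0 y, Submodule.neg_mem _
    (prismOp_mem_smoothChainsInSub hCc hCT hc ℝ ℝ (by rw [smoothChainsInSub_zero]; exact hy)),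
    isInt_neg (isInt_prismOp hCc hCT hc hyi), ?_⟩
  rw [map_neg, prism_identity_zero hCc hCT hc hy, coneOp_eq_coeffSum_smul, hsum, zero_smul, zero_sub,
    neg_neg]

include hCc hCT hc in
/-- **Smooth integer `1`-cycles bound smooth integer `2`-chains in a chart-convex set**:
`w = ∂((∑ w) • [q, q, q] − P w)` by the prism identity `∂P + P∂ = κ − 𝟙` in dimension `1`,
`κ w = (∑ w) • [q, q]` and `∂[q, q, q] = [q, q]`. [cite: Bredon1993, Lemma V.9.2] -/
theorem exists_bd_eq_of_bd_eq_zero_chartSet (w : CChain ℝ M 1)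
    (hw : w ∈ smoothChainsInSub I ℝ ℝ M (chartSet I p C) 1) (hwi : ∀ σ, ∃ m : ℤ, w σ = m)
    (hcyc : csingularChainComplex.bd ℝ 0 w = 0) :
    ∃ η : CChain ℝ M 2, η ∈ smoothChainsInSub I ℝ ℝ M (chartSet I p C) 2 ∧
      (∀ σ, ∃ m : ℤ, η σ = m) ∧ csingularChainComplex.bd ℝ 1 η = w := by
  obtain ⟨k, hk⟩ := exists_coeffSum_eq_of_isInt hwi
  set q : M := (extChartAt I p).symm c with hq
  refine ⟨Compression.coeffSum ℝ 1 w • Finsupp.single (SingularSimplex.constAt q 2) (1 : ℝ) -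
      prismOp hCc hCT hc ℝ ℝ 1 w,
    Submodule.sub_mem _ (Submodule.smul_mem _ _ (single_constAt_mem_smoothChainsInSub hCT hc ℝ 2))
      (prismOp_mem_smoothChainsInSub hCc hCT hc ℝ ℝ hw), ?_, ?_⟩
  · rw [hk]
    exact isInt_sub (by
      have h := isInt_smul (isInt_single (SingularSimplex.constAt q 2) 1) k
      rwa [Int.cast_one] at h) (isInt_prismOp hCc hCT hc hwi)
  · have hid := prism_identity_succ hCc hCT hc (m := 0) (R := ℝ) (A := ℝ) (x := w) hw.2
    rw [hcyc, map_zero, add_zero, coneOp_eq_coeffSum_smul] at hid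
    rw [map_sub, map_smul, bd_single_constAt, if_neg Nat.not_even_one]
    change _ - csingularChainComplex.bd ℝ (0 + 1) (prismOp hCc hCT hc ℝ ℝ (0 + 1) w) = w
    rw [hid]
    change Compression.coeffSum ℝ 1 w • Finsupp.single (SingularSimplex.constAt q 1) (1 : ℝ) -
      (Compression.coeffSum ℝ 1 w • Finsupp.single (SingularSimplex.constAt q 1) (1 : ℝ) - w) = w
    abel

/-- **Integer `0`-chains of total multiplicity zero bound smooth integer `1`-chains** in a set which
is empty or a chart set of a nonempty convex subset of a chart target. [cite: Bredon1993, Lemma V.9.2] -/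
theorem exists_bd_eq_of_coeffSum_eq_zero {W : Set M}
    (hW : W = ∅ ∨ ∃ (p : M) (C : Set E) (c : E), Convex ℝ C ∧ C ⊆ (extChartAt I p).target ∧ c ∈ C ∧
      W = chartSet I p C)
    (y : CChain ℝ M 0) (hy : y ∈ chainsIn ℝ ℝ M W 0) (hyi : ∀ σ, ∃ m : ℤ, y σ = m)
    (hsum : Compression.coeffSum ℝ 0 y = 0) :
    ∃ η : CChain ℝ M 1, η ∈ smoothChainsInSub I ℝ ℝ M W 1 ∧
      (∀ σ, ∃ m : ℤ, η σ = m) ∧ csingularChainComplex.bd ℝ 0 η = y := by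
  rcases hW with rfl | ⟨p, C, c, hCc, hCT, hc, rfl⟩
  · have h0 : y = 0 := eq_zero_of_mem_chainsIn_empty hy
    exact ⟨0, Submodule.zero_mem _, isInt_zero, by rw [h0, map_zero]⟩
  · exact exists_bd_eq_of_coeffSum_eq_zero_chartSet hCc hCT hc y hy hyi hsum

/-- **Smooth integer `1`-cycles bound smooth integer `2`-chains** in a set which is empty or a chart
set of a nonempty convex subset of a chart target. [cite: Bredon1993, Lemma V.9.2] -/
theorem exists_bd_eq_of_bd_eq_zero {W : Set M}
    (hW : W = ∅ ∨ ∃ (p : M) (C : Set E) (c : E), Convex ℝ C ∧ C ⊆ (extChartAt I p).target ∧ c ∈ C ∧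
      W = chartSet I p C)
    (w : CChain ℝ M 1) (hw : w ∈ smoothChainsInSub I ℝ ℝ M W 1) (hwi : ∀ σ, ∃ m : ℤ, w σ = m)
    (hcyc : csingularChainComplex.bd ℝ 0 w = 0) :
    ∃ η : CChain ℝ M 2, η ∈ smoothChainsInSub I ℝ ℝ M W 2 ∧
      (∀ σ, ∃ m : ℤ, η σ = m) ∧ csingularChainComplex.bd ℝ 1 η = w := by
  rcases hW with rfl | ⟨p, C, c, hCc, hCT, hc, rfl⟩
  · have h0 : w = 0 := eq_zero_of_mem_chainsIn_empty hw.2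
    exact ⟨0, Submodule.zero_mem _, isInt_zero, by rw [h0, map_zero]⟩
  · exact exists_bd_eq_of_bd_eq_zero_chartSet hCc hCT hc w hw hwi hcyc

end Fillings



/-! ### Stokes and linearity for the integration functional on smooth chains of an open set -/

section Stokes

variable {E : Type u} [NormedAddCommGroup E] [NormedSpace ℝ E]
  {H : Type u} [TopologicalSpace H] {I : ModelWithCorners ℝ E H}
  {M : Type u} [TopologicalSpace M] [ChartedSpace H M]

/-- Forms which agree on `A` have the same integrals over chains of `A`. [folklore] -/
theorem integrationFunctional_congr {A : Set M} {k : ℕ} {η₁ η₂ : MForm I M ℝ k}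
    (h : ∀ x ∈ A, η₁ x = η₂ x) {c : CChain ℝ M k} (hc : c ∈ chainsIn ℝ ℝ M A k) :
    integrationFunctional η₁ c = integrationFunctional η₂ c := by
  rw [integrationFunctional_apply, integrationFunctional_apply]
  refine Finset.sum_congr rfl fun σ hσ ↦ ?_
  rw [SingularSimplex.formIntegral_congr σ fun x hx ↦ h x ((mem_chainsIn_iff ℝ ℝ c).1 hc σ hσ hx)]

/-- **A function integrates over the point chain at `x` to its value at `x`.**
[cite: LeeSmoothManifolds2013, p. 481] -/
theorem integrationFunctional_ofFun_single_constAt (g : M → ℝ) (x : M) (r : ℝ) :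
    integrationFunctional (MForm.ofFun I g) (Finsupp.single (SingularSimplex.constAt x 0) r) = r * g x := by
  rw [integrationFunctional_single, SingularSimplex.formIntegral_eq_of_zero,
    SingularSimplex.toContinuousMap_constAt_apply]
  rfl

variable [IsManifold I ∞ M]

/-- **Stokes on smooth chains of an open set, pointwise form**: if `η` is smooth at the points of
the open set `A` and `dη = β` there, then `∫_c β = ∫_{∂c} η` for every smooth chain `c` of `A`.
[cite: LeeSmoothManifolds2013, Thm. 18.12] -/
theorem integrationFunctional_eq_bd_of_mextDeriv_eq {A : Set M} (hA : IsOpen A) {k : ℕ}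
    {η : MForm I M ℝ k} (hη : ∀ x ∈ A, η.SmoothAt x) {β : MForm I M ℝ (k + 1)}
    (hd : ∀ x ∈ A, mextDeriv η x = β x) {c : CChain ℝ M (k + 1)}
    (hc : c ∈ smoothChainsInSub I ℝ ℝ M A (k + 1)) :
    integrationFunctional β c = integrationFunctional η (csingularChainComplex.bd ℝ k c) := by
  have hmem : η.restr A ∈ smoothFormsOn I ℝ A k :=
    ⟨fun x hx ↦ (MForm.smoothAt_restr_iff hA η hx).2 (hη x hx), fun x hx ↦ MForm.restr_apply_of_notMem η hx⟩
  have h := integrationFunctional_localD hA ⟨η.restr A, hmem⟩ hc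
  rw [coe_localD, integrationFunctional_restr _ hc.2] at h
  change integrationFunctional (mextDeriv (η.restr A)) c =
    integrationFunctional (η.restr A) (csingularChainComplex.bd ℝ k c) at h
  rw [integrationFunctional_restr _ (bd_mem_chainsIn (R := ℝ) (M := ℝ) hc.2)] at h
  rw [← h]
  exact (integrationFunctional_congr (fun x hx ↦ by rw [mextDeriv_restr_apply hA η hx, hd x hx]) hc.2).symm

/-- The integration functional of a difference of forms smooth at the points of `A`, on smooth chains
of `A`. [folklore] -/
theorem integrationFunctional_sub {A : Set M} {k : ℕ} {η₁ η₂ : MForm I M ℝ k}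
    (h₁ : ∀ x ∈ A, η₁.SmoothAt x) (h₂ : ∀ x ∈ A, η₂.SmoothAt x) {c : CChain ℝ M k}
    (hc : c ∈ smoothChainsInSub I ℝ ℝ M A k) :
    integrationFunctional (η₁ - η₂) c = integrationFunctional η₁ c - integrationFunctional η₂ c := by
  rw [integrationFunctional_apply, integrationFunctional_apply, integrationFunctional_apply,
    ← Finset.sum_sub_distrib]
  refine Finset.sum_congr rfl fun σ hσ ↦ ?_
  have hs : σ.IsSmooth I := (mem_smoothChains_iff c).1 hc.1 σ hσ
  have hU : σ.range ⊆ A := (mem_chainsIn_iff ℝ ℝ c).1 hc.2 σ hσ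
  rw [sub_eq_add_neg, SingularSimplex.formIntegral_add hs (fun x hx ↦ h₁ x (hU hx))
    (fun x hx ↦ (h₂ x (hU hx)).neg), show -η₂ = (-1 : ℝ) • η₂ from (neg_one_smul ℝ η₂).symm,
    SingularSimplex.formIntegral_smul, smul_eq_mul]
  ring

end Stokes


/-! ### The ordered nerve of a finite family: incidence numbers -/

section Nerve

variable {M : Type u} {ι : Type*} [Fintype ι] [DecidableEq ι] (U : ι → Set M)

open Classical in
/-- **Row sums against the triangle–edge incidence numbers of the ordered nerve**:
`∑_t B_{s t} g(t) = g(j,k) − g(i,k) + g(i,j)` for a nonempty ordered triple `s = (i, j, k)` (and `0`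
for an empty one, whose incidence numbers are set to `0`). [cite: BottTu1982Forms, §8 (8.4)] -/
theorem sum_nerveIncidence_mul {R : Type*} [CommRing R] (B : ι × ι × ι → ι × ι → ℤ)
    (hB : ∀ s t, B s t = if (U s.1 ∩ U s.2.1 ∩ U s.2.2).Nonempty then
      ((if t = (s.2.1, s.2.2) then 1 else 0) - (if t = (s.1, s.2.2) then 1 else 0) +
        (if t = (s.1, s.2.1) then 1 else 0)) else 0)
    (s : ι × ι × ι) (g : ι × ι → R) :
    ∑ t, (B s t : R) * g t = if (U s.1 ∩ U s.2.1 ∩ U s.2.2).Nonempty then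
      g (s.2.1, s.2.2) - g (s.1, s.2.2) + g (s.1, s.2.1) else 0 := by
  by_cases hne : (U s.1 ∩ U s.2.1 ∩ U s.2.2).Nonempty
  · simp_rw [hB, if_pos hne]
    push_cast
    simp only [sub_mul, add_mul, ite_mul, one_mul, zero_mul, Finset.sum_add_distrib,
      Finset.sum_sub_distrib, Finset.sum_ite_eq', Finset.mem_univ, if_true]
  · simp_rw [hB, if_neg hne]
    simp

/-- **Column sums against the edge–vertex incidence numbers**: `∑_i D_{t i} g(i) = g(b) − g(a)` for
the ordered pair `t = (a, b)`. [cite: BottTu1982Forms, §8 (8.4)] -/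
theorem sum_edgeIncidence_mul {R : Type*} [CommRing R] (D : ι × ι → ι → ℤ)
    (hD : ∀ t i, D t i = (if i = t.2 then 1 else 0) - (if i = t.1 then 1 else 0))
    (t : ι × ι) (g : ι → R) : ∑ i, (D t i : R) * g i = g t.2 - g t.1 := by
  simp_rw [hD]
  push_cast
  simp only [sub_mul, ite_mul, one_mul, zero_mul, Finset.sum_sub_distrib, Finset.sum_ite_eq',
    Finset.mem_univ, if_true]

open Classical in
/-- **`∂ ∘ ∂ = 0` on the ordered nerve**: `∑_t B_{s t} D_{t i} = 0`. [cite: BottTu1982Forms, §8 (8.4)] -/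
theorem sum_nerveIncidence_mul_edgeIncidence (B : ι × ι × ι → ι × ι → ℤ)
    (hB : ∀ s t, B s t = if (U s.1 ∩ U s.2.1 ∩ U s.2.2).Nonempty then
      ((if t = (s.2.1, s.2.2) then 1 else 0) - (if t = (s.1, s.2.2) then 1 else 0) +
        (if t = (s.1, s.2.1) then 1 else 0)) else 0)
    (D : ι × ι → ι → ℤ) (hD : ∀ t i, D t i = (if i = t.2 then 1 else 0) - (if i = t.1 then 1 else 0))
    (s : ι × ι × ι) (i : ι) : ∑ t, B s t * D t i = 0 := by
  have h := sum_nerveIncidence_mul U (R := ℤ) B hB s (fun t ↦ D t i)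
  simp only [Int.cast_id] at h
  rw [h]
  split_ifs
  · simp only [hD]
    ring
  · rfl

/-- The vertex incidence numbers of an edge sum to zero: `∑_i D_{t i} = 0`. [folklore] -/
theorem sum_edgeIncidence (D : ι × ι → ι → ℤ)
    (hD : ∀ t i, D t i = (if i = t.2 then 1 else 0) - (if i = t.1 then 1 else 0)) (t : ι × ι) :
    ∑ i, D t i = 0 := by
  have h := sum_edgeIncidence_mul (R := ℤ) D hD t (fun _ ↦ 1)
  simp only [Int.cast_id, mul_one, sub_self] at h
  exact h

open Classical in
omit [Fintype ι] in
/-- A nonzero triangle–edge incidence number forces the triple to be nonempty and the edge to be a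
face: `U_i ∩ U_j ∩ U_k ⊆ U_a ∩ U_b`. [folklore] -/
theorem subset_of_nerveIncidence_ne_zero (B : ι × ι × ι → ι × ι → ℤ)
    (hB : ∀ s t, B s t = if (U s.1 ∩ U s.2.1 ∩ U s.2.2).Nonempty then
      ((if t = (s.2.1, s.2.2) then 1 else 0) - (if t = (s.1, s.2.2) then 1 else 0) +
        (if t = (s.1, s.2.1) then 1 else 0)) else 0)
    {s : ι × ι × ι} {t : ι × ι} (h : B s t ≠ 0) :
    (U s.1 ∩ U s.2.1 ∩ U s.2.2).Nonempty ∧ U s.1 ∩ U s.2.1 ∩ U s.2.2 ⊆ U t.1 ∩ U t.2 := by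
  rw [hB] at h
  by_cases hne : (U s.1 ∩ U s.2.1 ∩ U s.2.2).Nonempty
  · refine ⟨hne, ?_⟩
    rw [if_pos hne] at h
    by_cases h1 : t = (s.2.1, s.2.2)
    · subst h1; intro x hx; exact ⟨hx.1.2, hx.2⟩
    by_cases h2 : t = (s.1, s.2.2)
    · subst h2; intro x hx; exact ⟨hx.1.1, hx.2⟩
    by_cases h3 : t = (s.1, s.2.1)
    · subst h3; intro x hx; exact ⟨hx.1.1, hx.1.2⟩
    rw [if_neg h1, if_neg h2, if_neg h3] at h
    exact absurd rfl h
  · rw [if_neg hne] at h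
    exact absurd rfl h

omit [Fintype ι] in
/-- A nonzero edge–vertex incidence number forces the vertex to be an end: `U_a ∩ U_b ⊆ U_i`.
[folklore] -/
theorem subset_of_edgeIncidence_ne_zero (D : ι × ι → ι → ℤ)
    (hD : ∀ t i, D t i = (if i = t.2 then 1 else 0) - (if i = t.1 then 1 else 0))
    {t : ι × ι} {i : ι} (h : D t i ≠ 0) : U t.1 ∩ U t.2 ⊆ U i := by
  rw [hD] at h
  by_cases h1 : i = t.2
  · subst h1; exact Set.inter_subset_right
  by_cases h2 : i = t.1
  · subst h2; exact Set.inter_subset_left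
  rw [if_neg h1, if_neg h2] at h
  exact absurd rfl h

end Nerve

/-! ### The smooth integer cycle of a nerve cycle, and its periods against a zigzag -/

section Cycle

variable {E : Type u} [NormedAddCommGroup E] [NormedSpace ℝ E]
  {H : Type u} [TopologicalSpace H] {I : ModelWithCorners ℝ E H}
  {M : Type u} [TopologicalSpace M] [ChartedSpace H M] [IsManifold I ∞ M]
  {ι : Type*} [Fintype ι] [DecidableEq ι] {U : ι → Set M}

open Classical in
/-- **The smooth integer cycle of a nerve cycle and its periods** (the homological tic-tac-toe of
the Čech–de Rham–singular comparison in degree `2`; Weil (1952), §3, Bott–Tu (1982), Prop. 9.5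
read on chains). Let `(U_i)` be a finite open family all of whose members and pairwise
intersections are empty or chart sets of nonempty convex sets, `B` the triangle–edge incidence
numbers of its ordered nerve and `m` an integer `2`-cycle of the nerve (`∑_s m_s B_{s t} = 0`). Then
there is a smooth singular `2`-cycle `S` of `M` with INTEGER coefficients such that for every real
zigzag — `θ = dα_i` on `U_i`, `α_i − α_j = df_ij` on `U_i ∩ U_j`, `f_ij + f_jk − f_ik = c_ijk` on
`U_i ∩ U_j ∩ U_k` — the period of `θ` over `S` is `∫_S θ = −∑_s m_s c_s`. Construction: points
`x_s ∈ U_s`, paths in `U_a ∩ U_b` bounding the `0`-chains `y_t = ∑_s m_s B_{s t} [x_s]`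
(`exists_bd_eq_of_coeffSum_eq_zero`), `2`-chains in `U_i` bounding the resulting `1`-cycles
(`exists_bd_eq_of_bd_eq_zero`); the period is computed by three applications of Stokes' formula.
[cite: BottTu1982Forms, Prop. 9.5] -/
theorem exists_smooth_int_cycle_period_eq (hU : ∀ i, IsOpen (U i))
    (hgood₁ : ∀ i, U i = ∅ ∨ ∃ (p : M) (C : Set E) (c : E), Convex ℝ C ∧ C ⊆ (extChartAt I p).target ∧
      c ∈ C ∧ U i = chartSet I p C)
    (hgood₂ : ∀ i j, U i ∩ U j = ∅ ∨ ∃ (p : M) (C : Set E) (c : E), Convex ℝ C ∧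
      C ⊆ (extChartAt I p).target ∧ c ∈ C ∧ U i ∩ U j = chartSet I p C)
    (B : ι × ι × ι → ι × ι → ℤ)
    (hB : ∀ s t, B s t = if (U s.1 ∩ U s.2.1 ∩ U s.2.2).Nonempty then
      ((if t = (s.2.1, s.2.2) then 1 else 0) - (if t = (s.1, s.2.2) then 1 else 0) +
        (if t = (s.1, s.2.1) then 1 else 0)) else 0)
    (m : ι × ι × ι → ℤ) (hm : ∀ t, ∑ s, m s * B s t = 0) :
    ∃ S : CChain ℝ M 2, S ∈ smoothChains I ℝ ℝ M 2 ∧ (∀ σ, ∃ n : ℤ, S σ = n) ∧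
      csingularChainComplex.bd ℝ 1 S = 0 ∧
      ∀ (θ : MForm I M ℝ 2) (α : ι → MForm I M ℝ 1) (f : ι → ι → M → ℝ) (c : ι → ι → ι → ℝ),
        (∀ i, ∀ x ∈ U i, (α i).SmoothAt x) → (∀ i, ∀ x ∈ U i, mextDeriv (α i) x = θ x) →
        (∀ i j, ∀ x ∈ U i ∩ U j, (MForm.ofFun I (f i j)).SmoothAt x) →
        (∀ i j, ∀ x ∈ U i ∩ U j, mextDeriv (MForm.ofFun I (f i j)) x = α i x - α j x) →
        (∀ i j k, ∀ x ∈ U i ∩ U j ∩ U k, f i j x + f j k x - f i k x = c i j k) →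
        integrationFunctional θ S =
          -∑ s, (m s : ℝ) * (if (U s.1 ∩ U s.2.1 ∩ U s.2.2).Nonempty then c s.1 s.2.1 s.2.2 else 0) := by
  classical
  -- the edge–vertex incidence numbers
  set D : ι × ι → ι → ℤ := fun t i ↦ (if i = t.2 then 1 else 0) - (if i = t.1 then 1 else 0) with hDdef
  have hD : ∀ t i, D t i = (if i = t.2 then 1 else 0) - (if i = t.1 then 1 else 0) := fun _ _ ↦ rfl
  -- Step 0: the point chains `[x_s]`
  set pt : ι × ι × ι → CChain ℝ M 0 := fun s ↦
    if h : (U s.1 ∩ U s.2.1 ∩ U s.2.2).Nonempty then Finsupp.single (SingularSimplex.constAt h.some 0) 1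
    else 0 with hpt
  have hpt_mem : ∀ s, pt s ∈ chainsIn ℝ ℝ M (U s.1 ∩ U s.2.1 ∩ U s.2.2) 0 := fun s ↦ by
    by_cases h : (U s.1 ∩ U s.2.1 ∩ U s.2.2).Nonempty
    · rw [hpt]; simp only [dif_pos h]
      refine single_mem_chainsIn ℝ ℝ ?_ _
      rw [SingularSimplex.range_constAt, Set.singleton_subset_iff]
      exact h.some_mem
    · rw [hpt]; simp only [dif_neg h]
      exact Submodule.zero_mem _
  have hpt_int : ∀ s, ∀ σ, ∃ n : ℤ, pt s σ = n := fun s ↦ by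
    by_cases h : (U s.1 ∩ U s.2.1 ∩ U s.2.2).Nonempty
    · rw [hpt]; simp only [dif_pos h]
      have e := isInt_single (X := M) (SingularSimplex.constAt h.some 0) 1
      rwa [Int.cast_one] at e
    · rw [hpt]; simp only [dif_neg h]
      exact isInt_zero
  have hpt_sum : ∀ s, Compression.coeffSum ℝ 0 (pt s) =
      if (U s.1 ∩ U s.2.1 ∩ U s.2.2).Nonempty then 1 else 0 := fun s ↦ by
    by_cases h : (U s.1 ∩ U s.2.1 ∩ U s.2.2).Nonempty
    · rw [hpt]; simp only [dif_pos h, if_pos h, Compression.coeffSum_single]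
    · rw [hpt]; simp only [dif_neg h, if_neg h, map_zero]
  have hpt_ofFun : ∀ (g : M → ℝ) (s : ι × ι × ι), integrationFunctional (MForm.ofFun I g) (pt s) =
      if h : (U s.1 ∩ U s.2.1 ∩ U s.2.2).Nonempty then g h.some else 0 := fun g s ↦ by
    by_cases h : (U s.1 ∩ U s.2.1 ∩ U s.2.2).Nonempty
    · rw [hpt]; simp only [dif_pos h, integrationFunctional_ofFun_single_constAt, one_mul]
    · rw [hpt]; simp only [dif_neg h, map_zero]
  -- Step 1: the `0`-chains `y_t = ∑_s m_s B_{s t} [x_s]` of the pairwise intersections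
  set y : ι × ι → CChain ℝ M 0 := fun t ↦ ∑ s, ((m s : ℝ) * (B s t : ℝ)) • pt s with hy
  have hy_mem : ∀ t, y t ∈ chainsIn ℝ ℝ M (U t.1 ∩ U t.2) 0 := fun t ↦ by
    refine Submodule.sum_mem _ fun s _ ↦ ?_
    by_cases hB0 : B s t = 0
    · rw [hB0, Int.cast_zero, mul_zero, zero_smul]; exact Submodule.zero_mem _
    · exact Submodule.smul_mem _ _
        (chainsIn_mono ℝ ℝ (subset_of_nerveIncidence_ne_zero U B hB hB0).2 0 (hpt_mem s))
  have hy_int : ∀ t, ∀ σ, ∃ n : ℤ, y t σ = n := fun t ↦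
    isInt_sum fun s _ ↦ by
      have e := isInt_smul (hpt_int s) (m s * B s t)
      rwa [Int.cast_mul] at e
  have hy_sum : ∀ t, Compression.coeffSum ℝ 0 (y t) = 0 := fun t ↦ by
    rw [hy]; simp only [map_sum, map_smul, hpt_sum, smul_eq_mul, mul_ite, mul_one, mul_zero]
    have e : ∀ s, (if (U s.1 ∩ U s.2.1 ∩ U s.2.2).Nonempty then (m s : ℝ) * (B s t : ℝ) else 0) =
        (m s : ℝ) * (B s t : ℝ) := fun s ↦ by
      split_ifs with h
      · rfl
      · rw [hB, if_neg h, Int.cast_zero, mul_zero]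
    simp only [e]
    have := congrArg (Int.cast : ℤ → ℝ) (hm t)
    push_cast at this
    exact this
  -- Step 2: paths `η_t` in `U_a ∩ U_b` with `∂η_t = y_t`
  have hη : ∀ t : ι × ι, ∃ η : CChain ℝ M 1, η ∈ smoothChainsInSub I ℝ ℝ M (U t.1 ∩ U t.2) 1 ∧
      (∀ σ, ∃ n : ℤ, η σ = n) ∧ csingularChainComplex.bd ℝ 0 η = y t := fun t ↦
    exists_bd_eq_of_coeffSum_eq_zero (hgood₂ t.1 t.2) (y t) (hy_mem t) (hy_int t) (hy_sum t)
  choose η hη_mem hη_int hη_bd using hη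
  -- Step 3: the `1`-cycles `w_i = ∑_t D_{t i} η_t` of the members
  set w : ι → CChain ℝ M 1 := fun i ↦ ∑ t, (D t i : ℝ) • η t with hw
  have hw_mem : ∀ i, w i ∈ smoothChainsInSub I ℝ ℝ M (U i) 1 := fun i ↦ by
    refine Submodule.sum_mem _ fun t _ ↦ ?_
    by_cases hD0 : D t i = 0
    · rw [hD0, Int.cast_zero, zero_smul]; exact Submodule.zero_mem _
    · exact Submodule.smul_mem _ _
        (smoothChainsInSub_mono (I := I) (R := ℝ) (A := ℝ) (subset_of_edgeIncidence_ne_zero U D hD hD0) 1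
          (hη_mem t))
  have hw_int : ∀ i, ∀ σ, ∃ n : ℤ, w i σ = n := fun i ↦
    isInt_sum fun t _ ↦ isInt_smul (hη_int t) (D t i)
  have hw_bd : ∀ i, csingularChainComplex.bd ℝ 0 (w i) = 0 := fun i ↦ by
    rw [hw]; simp only [map_sum, map_smul, hη_bd]
    -- `∑_t D_{t i} y_t = ∑_s m_s (∑_t B_{s t} D_{t i}) [x_s] = 0`
    rw [hy]; simp only [Finset.smul_sum, smul_smul]
    rw [Finset.sum_comm]
    refine Finset.sum_eq_zero fun s _ ↦ ?_
    rw [← Finset.sum_smul]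
    have e : ∑ t, (D t i : ℝ) * ((m s : ℝ) * (B s t : ℝ)) = (m s : ℝ) * ((∑ t, B s t * D t i : ℤ) : ℝ) := by
      push_cast
      rw [Finset.mul_sum]
      exact Finset.sum_congr rfl fun t _ ↦ by ring
    rw [e, sum_nerveIncidence_mul_edgeIncidence U B hB D hD s i, Int.cast_zero, mul_zero, zero_smul]
  -- Step 4: `2`-chains `η₂_i` in `U_i` with `∂η₂_i = w_i`
  have hη₂ : ∀ i, ∃ η₂ : CChain ℝ M 2, η₂ ∈ smoothChainsInSub I ℝ ℝ M (U i) 2 ∧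
      (∀ σ, ∃ n : ℤ, η₂ σ = n) ∧ csingularChainComplex.bd ℝ 1 η₂ = w i := fun i ↦
    exists_bd_eq_of_bd_eq_zero (hgood₁ i) (w i) (hw_mem i) (hw_int i) (hw_bd i)
  choose η₂ hη₂_mem hη₂_int hη₂_bd using hη₂
  -- Step 5: the cycle `S = ∑_i η₂_i`
  refine ⟨∑ i, η₂ i, Submodule.sum_mem _ fun i _ ↦ (hη₂_mem i).1, isInt_sum fun i _ ↦ hη₂_int i, ?_, ?_⟩
  · rw [map_sum]
    simp only [hη₂_bd]
    rw [hw]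
    change ∑ i, ∑ t, (D t i : ℝ) • η t = 0
    rw [Finset.sum_comm]
    refine Finset.sum_eq_zero fun t _ ↦ ?_
    rw [← Finset.sum_smul]
    have e : ∑ i, (D t i : ℝ) = ((∑ i, D t i : ℤ) : ℝ) := by push_cast; rfl
    rw [e, sum_edgeIncidence D hD t, Int.cast_zero, zero_smul]
  -- Step 6: the period of a zigzag
  intro θ α f c hα hdα hfs hdf hc
  -- first Stokes: `∫_S θ = ∑_i ∫_{w_i} α_i`
  have h1 : integrationFunctional θ (∑ i, η₂ i) = ∑ i, integrationFunctional (α i) (w i) := by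
    rw [map_sum]
    refine Finset.sum_congr rfl fun i _ ↦ ?_
    rw [← hη₂_bd i]
    exact integrationFunctional_eq_bd_of_mextDeriv_eq (hU i) (hα i) (hdα i) (hη₂_mem i)
  -- rearrangement: `∑_i ∫_{w_i} α_i = ∑_t (∫_{η_t} α_b − ∫_{η_t} α_a)`
  have h2 : ∑ i, integrationFunctional (α i) (w i) =
      ∑ t : ι × ι, (integrationFunctional (α t.2) (η t) - integrationFunctional (α t.1) (η t)) := by
    have e : ∀ i, integrationFunctional (α i) (w i) = ∑ t, (D t i : ℝ) * integrationFunctional (α i) (η t) :=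
      fun i ↦ by rw [hw]; simp only [map_sum, map_smul, smul_eq_mul]
    simp only [e]
    rw [Finset.sum_comm]
    exact Finset.sum_congr rfl fun t _ ↦ sum_edgeIncidence_mul D hD t (fun i ↦ integrationFunctional (α i) (η t))
  -- second Stokes: `∫_{η_t} (α_a − α_b) = ∫_{∂η_t} f_ab = f_ab(y_t)`
  have h3 : ∀ t : ι × ι, integrationFunctional (α t.2) (η t) - integrationFunctional (α t.1) (η t) =
      -integrationFunctional (MForm.ofFun I (f t.1 t.2)) (y t) := fun t ↦ by
    rw [← hη_bd t, ← integrationFunctional_eq_bd_of_mextDeriv_eq ((hU t.1).inter (hU t.2)) (hfs t.1 t.2)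
      (β := α t.1 - α t.2) (fun x hx ↦ hdf t.1 t.2 x hx) (hη_mem t),
      integrationFunctional_sub (fun x hx ↦ hα t.1 x hx.1) (fun x hx ↦ hα t.2 x hx.2) (hη_mem t)]
    ring
  -- evaluation: `f_ab(y_t) = ∑_s m_s B_{s t} f_ab(x_s)`
  have h4 : ∀ t : ι × ι, integrationFunctional (MForm.ofFun I (f t.1 t.2)) (y t) =
      ∑ s, (m s : ℝ) * (B s t : ℝ) *
        (if h : (U s.1 ∩ U s.2.1 ∩ U s.2.2).Nonempty then f t.1 t.2 h.some else 0) := fun t ↦ by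
    rw [hy]; simp only [map_sum, map_smul, smul_eq_mul, hpt_ofFun]
  -- the cocycle relation at the chosen points
  have h5 : ∀ s : ι × ι × ι, ∑ t, (B s t : ℝ) *
      (if h : (U s.1 ∩ U s.2.1 ∩ U s.2.2).Nonempty then f t.1 t.2 h.some else 0) =
      if (U s.1 ∩ U s.2.1 ∩ U s.2.2).Nonempty then c s.1 s.2.1 s.2.2 else 0 := fun s ↦ by
    rw [sum_nerveIncidence_mul U B hB s]
    by_cases h : (U s.1 ∩ U s.2.1 ∩ U s.2.2).Nonempty
    · simp only [dif_pos h, if_pos h]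
      have := hc s.1 s.2.1 s.2.2 h.some h.some_mem
      linarith
    · simp only [if_neg h]
  rw [h1, h2, Finset.sum_congr rfl fun t _ ↦ h3 t, Finset.sum_neg_distrib]
  simp only [h4]
  rw [Finset.sum_comm]
  congr 1
  refine Finset.sum_congr rfl fun s _ ↦ ?_
  rw [← h5 s, Finset.mul_sum]
  exact Finset.sum_congr rfl fun t _ ↦ by ring

end Cycle


/-! ### Periods of de Rham classes over smooth cycles via the comparison isomorphism -/

section Pairing

variable {E : Type u} [NormedAddCommGroup E] [NormedSpace ℝ E] [FiniteDimensional ℝ E]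
  {H : Type u} [TopologicalSpace H] {I : ModelWithCorners ℝ E H} [I.Boundaryless]
  {M : Type u} [TopologicalSpace M] [ChartedSpace H M] [IsManifold I ∞ M] [T2Space M]
  [SecondCountableTopology M] [LocallyCompactSpace M]

omit [FiniteDimensional ℝ E] [I.Boundaryless] [ChartedSpace H M] [IsManifold I ∞ M] [T2Space M]
  [SecondCountableTopology M] [LocallyCompactSpace M] in
/-- A singular cocycle is a cycle of the singular cochain complex (elementwise form of
`iCycles ≫ d = 0`). [folklore] -/
theorem d_apply_iCocycles_eq_zero {k : ℕ} (ζ : singularCochainComplex.cocycles ℝ ℝ M k) :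
    (singularCochainComplex ℝ ℝ M).d k ((ComplexShape.up ℕ).next k)
      (singularCochainComplex.iCocycles ℝ ℝ M k ζ) = 0 := by
  simp

omit [FiniteDimensional ℝ E] [I.Boundaryless] [ChartedSpace H M] [IsManifold I ∞ M] [T2Space M]
  [SecondCountableTopology M] [LocallyCompactSpace M] in
/-- The class `π ζ` of a singular cocycle is the homology class of its underlying cochain.
[folklore] -/
theorem π_eq_homologyCls_iCocycles {k : ℕ} (ζ : singularCochainComplex.cocycles ℝ ℝ M k) :
    singularCohomology.π ℝ ℝ M k ζ =
      homologyCls (K := singularCochainComplex ℝ ℝ M) (singularCochainComplex.iCocycles ℝ ℝ M k ζ)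
        (d_apply_iCocycles_eq_zero (M := M) ζ) := by
  have hz : (singularCochainComplex ℝ ℝ M).d k (k + 1) (singularCochainComplex.iCocycles ℝ ℝ M k ζ) = 0 := by
    simp
  rw [homologyCls_eq_homologyπ_cyclesMk _ _ (k + 1) ((ComplexShape.up ℕ).next_eq' rfl) hz]
  change _ = singularCohomology.π ℝ ℝ M k _
  congr 1
  apply (ModuleCat.mono_iff_injective ((singularCochainComplex ℝ ℝ M).iCycles k)).mp inferInstance
  exact ((singularCochainComplex ℝ ℝ M).i_cyclesMk _ _ _ hz).symm

/-- **Periods of a de Rham class over smooth cycles are computed by any singular cocycle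
representing its image under the de Rham comparison isomorphism** (integration over smooth
simplices): if `comparison [θ] = [ζ]` in `Hᵏ⁺¹(M; ℝ)` then `∫_S θ = ∑_σ S_σ ζ(σ)` for every smooth
singular `(k+1)`-cycle `S` — the integration cochain of `θ` and the restriction of `ζ` to smooth
chains are cohomologous in `Hom(Δ^{sm}(M), ℝ)` (`deRhamComparisonIso_hom_comp`), and coboundaries
vanish on cycles. [cite: Bredon1993, Thm. V.9.5] -/
theorem integrationFunctional_eq_sum_of_comparison_eq_π {k : ℕ} (θ : closedSmoothForms I M ℝ (k + 1))
    (ζ : singularCochainComplex.cocycles ℝ ℝ M (k + 1))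
    (h : (deRhamComparisonIso I M (k + 1)).hom (deRhamIsoLocal I M ℝ (k + 1) (deRhamCohomology.mk θ)) =
      singularCohomology.π ℝ ℝ M (k + 1) ζ)
    (S : CChain ℝ M (k + 1)) (hS : S ∈ smoothChains I ℝ ℝ M (k + 1))
    (hcyc : csingularChainComplex.bd ℝ k S = 0) :
    integrationFunctional (θ : MForm I M ℝ (k + 1)) S =
      ∑ σ ∈ S.support, S σ * (singularCochainComplex.iCocycles ℝ ℝ M (k + 1) ζ) σ := by
  -- apply `H(singIso) ≫ H(toSmoothAll)` to `h`
  have h1 : (HomologicalComplex.homologyMap (deRhamMap I (isOpen_univ : IsOpen (univ : Set M))) (k + 1))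
      (deRhamIsoLocal I M ℝ (k + 1) (deRhamCohomology.mk θ)) =
      HomologicalComplex.homologyMap (toSmoothAll I M) (k + 1)
        (HomologicalComplex.homologyMap (singIso M).hom (k + 1) (singularCohomology.π ℝ ℝ M (k + 1) ζ)) := by
    rw [← h, ← deRhamComparisonIso_hom_comp]
    rfl
  rw [deRhamIsoLocal_mk, homologyMap_homologyCls, π_eq_homologyCls_iCocycles,
    homologyMap_homologyCls, homologyMap_homologyCls, homologyCls_eq_homologyCls_iff,
    exists_d_prev_eq_iff ((ComplexShape.down ℕ).symm.prev_eq' (rfl : k + 1 = k + 1))] at h1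
  obtain ⟨w, hw⟩ := h1
  -- evaluate at the smooth cycle `S`
  set Sc : (smoothChainsInSub I ℝ ℝ M univ).toComplex.X (k + 1) :=
    ⟨S, by rw [smoothChainsInSub_univ]; exact hS⟩ with hSc
  have hval := congrArg (fun ψ ↦ cochainVal ψ Sc) hw
  simp only at hval
  -- the left-hand side vanishes: `S` is a cycle
  have hd0 : (smoothChainsInSub I ℝ ℝ M univ).toComplex.d (k + 1) k Sc = 0 := by
    apply Subtype.ext
    rw [toComplex_d_val]
    exact hcyc
  have hL : cochainVal ((smoothSubsetCochains I ℝ realCoeff M univ).d k (k + 1) w) Sc = 0 := by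
    rw [dualObj_d_apply]
    change (ModuleCat.Hom.hom w ((smoothChainsInSub I ℝ ℝ M univ).toComplex.d (k + 1) k Sc)).down = 0
    rw [hd0, map_zero]
    rfl
  rw [hL] at hval
  -- the right-hand side is `∫_S θ - ∑_σ S_σ ζ(σ)`
  have hA : cochainVal ((deRhamMap I (isOpen_univ : IsOpen (univ : Set M))).f (k + 1)
      (closedToUniv I M ℝ (k + 1) θ)) Sc = integrationFunctional (θ : MForm I M ℝ (k + 1)) S :=
    deRhamMap_cochainVal _ (k + 1) _ Sc
  set L : CChain ℝ M (k + 1) →ₗ[ℝ] ℝ := ULift.moduleEquiv.toLinearMap ∘ₗ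
    ModuleCat.Hom.hom ((singIso M).hom.f (k + 1) (singularCochainComplex.iCocycles ℝ ℝ M (k + 1) ζ)) with hLdef
  have hLsingle : ∀ (σ : SingularSimplex M (k + 1)) (r : ℝ),
      L (Finsupp.single σ r) = r * (singularCochainComplex.iCocycles ℝ ℝ M (k + 1) ζ) σ := fun σ r ↦ by
    have e := singIso_hom_f_apply_single (singularCochainComplex.iCocycles ℝ ℝ M (k + 1) ζ) σ r
    rw [hLdef, LinearMap.comp_apply]
    exact congrArg ULift.down e
  have hB : cochainVal ((toSmoothAll I M).f (k + 1)
      ((singIso M).hom.f (k + 1) (singularCochainComplex.iCocycles ℝ ℝ M (k + 1) ζ))) Sc =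
      ∑ σ ∈ S.support, S σ * (singularCochainComplex.iCocycles ℝ ℝ M (k + 1) ζ) σ := by
    have e : cochainVal ((toSmoothAll I M).f (k + 1)
        ((singIso M).hom.f (k + 1) (singularCochainComplex.iCocycles ℝ ℝ M (k + 1) ζ))) Sc = L S := rfl
    rw [e]
    conv_lhs => rw [← Finsupp.sum_single S]
    rw [Finsupp.sum, map_sum]
    exact Finset.sum_congr rfl fun σ _ ↦ hLsingle σ _
  have hsub : cochainVal ((deRhamMap I (isOpen_univ : IsOpen (univ : Set M))).f (k + 1)
        (closedToUniv I M ℝ (k + 1) θ) -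
      (toSmoothAll I M).f (k + 1) ((singIso M).hom.f (k + 1)
        (singularCochainComplex.iCocycles ℝ ℝ M (k + 1) ζ))) Sc =
      cochainVal ((deRhamMap I (isOpen_univ : IsOpen (univ : Set M))).f (k + 1)
        (closedToUniv I M ℝ (k + 1) θ)) Sc -
      cochainVal ((toSmoothAll I M).f (k + 1)
        ((singIso M).hom.f (k + 1) (singularCochainComplex.iCocycles ℝ ℝ M (k + 1) ζ))) Sc :=
    rfl
  rw [hsub, hA, hB] at hval
  linarith

end Pairing

end Literature.Geometry.Manifold
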